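import Summits.RiemannHypothesis.RiemannHypothesis.Theorems.HandoffEdgeAlmostAll
import HarnessLib

/-!
# HANDOFF, edge block: almost all primes UP TO `x` — the cumulative exceptional set has `≪ x^{1/10+ε}` elements (rh-explicit, track «HANDOFF», seat prove-2 gen3, ATTEMPT-10 §4)

HONEST FRAMING. Nothing here bears on RH. Continuation of `HandoffEdgeAlmostAll.lean`, which bounds the exceptional primes
of one dyadic block `(x/2, x]` by `C·x^{1/10+ε}` given the named fact `HeathBrown2021_sqrtGapSum` (Heath-Brown 2021,
Differences V, Thm 1; `Literature/NumberTheory/LFunctions/HeathBrownLargeGapSum.lean`). Here the blocks are summed: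

* `edgeExceptionalUpTo x` — the indices `n` with `e⁸⁰ ≤ p_n ≤ x` and `p_{n+1} − p_n > ½·√p_n·log p_n` (DEFINITION);
  `edgeNonneg_nth_of_not_mem_edgeExceptionalUpTo` — off this set, `EdgeNonneg p_n p_{n+1} η` for `0 < η ≤ 1/(4p_n)` (PROVED).
* `card_edgeExceptionalUpTo_le` — GIVEN the named fact: `∀ ε > 0 ∃ C ∀ x > 0, #(edgeExceptionalUpTo x) ≤ C·x^{1/10+ε}`
  (PROVED: `#E(x) ≤ #E(x/2) + #block(x)`, induction over `x < e⁸⁰·2^k`, geometric factor `S = 1/(1 − 2^{−(1/10+ε)})`).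
* `edgeNonneg_almost_all_upTo` — the two together: **the edge block of the handoff holds at all but `≪ x^{1/10+ε}` of the
  primes `e⁸⁰ ≤ p ≤ x`, unconditionally given Heath-Brown's theorem** (PROVED, CONDITIONAL on the named fact).

DOES NOT GIVE anything at an exceptional prime, nor anything about the coupling law / `H(q)`.
-/

set_option linter.dupNamespace false

noncomputable section

open Complex Filter Set MeasureTheory Literature.NumberTheory.LFunctions
open scoped Real Topology ComplexConjugate ContDiff

namespace Summit.RiemannHypothesis.RiemannHypothesis.Theorems.Handoff

/-! ## §1 The cumulative exceptional set and the dyadic summation -/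

/-- The cumulative exceptional indices: `n ≤ ⌊x⌋` with `e⁸⁰ ≤ p_n ≤ x` and `p_{n+1} − p_n > ½·√p_n·log p_n` — the primes up
to `x` in the range of `edgeNonneg_of_gap_le` at which its gap hypothesis fails. [this track, ATTEMPT-10 §4] -/
def edgeExceptionalUpTo (x : ℝ) : Finset ℕ :=
  (Finset.range (⌊x⌋₊ + 1)).filter (fun n ↦ Real.exp 80 ≤ (Nat.nth Nat.Prime n : ℝ) ∧ (Nat.nth Nat.Prime n : ℝ) ≤ x ∧
    Real.sqrt (Nat.nth Nat.Prime n) * Real.log (Nat.nth Nat.Prime n) / 2 <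
      (Nat.nth Nat.Prime (n + 1) : ℝ) - Nat.nth Nat.Prime n)

/-- Below `e⁸⁰` there are no cumulative exceptional indices (by definition). [folklore] -/
theorem edgeExceptionalUpTo_eq_empty {x : ℝ} (hx : x < Real.exp 80) : edgeExceptionalUpTo x = ∅ := by
  refine Finset.eq_empty_of_forall_notMem fun n hn ↦ ?_
  obtain ⟨-, h80, hle, -⟩ := Finset.mem_filter.1 hn
  linarith

/-- Dyadic step: an exceptional index up to `x` is exceptional up to `x/2` or lies in the block `(x/2, x]`. [folklore] -/
theorem edgeExceptionalUpTo_subset (x : ℝ) :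
    edgeExceptionalUpTo x ⊆ edgeExceptionalUpTo (x / 2) ∪ edgeExceptional x := by
  intro n hn
  obtain ⟨hr, h80, hle, hgap⟩ := Finset.mem_filter.1 hn
  rw [Finset.mem_union]
  by_cases h : (Nat.nth Nat.Prime n : ℝ) ≤ x / 2
  · exact Or.inl (Finset.mem_filter.2 ⟨mem_range_of_nth_le h, h80, h, hgap⟩)
  · exact Or.inr (Finset.mem_filter.2 ⟨hr, lt_of_not_ge h, hle, hgap⟩)

/-- **The edge block off the cumulative exceptional set.** For `e⁸⁰ ≤ p_n ≤ x` with `n ∉ edgeExceptionalUpTo x`: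
`EdgeNonneg p_n p_{n+1} η` for every `0 < η ≤ 1/(4p_n)`. [this track, ATTEMPT-10 §4] -/
theorem edgeNonneg_nth_of_not_mem_edgeExceptionalUpTo {n : ℕ} {x : ℝ} (hq : Real.exp 80 ≤ (Nat.nth Nat.Prime n : ℝ))
    (hhi : (Nat.nth Nat.Prime n : ℝ) ≤ x) (hn : n ∉ edgeExceptionalUpTo x)
    {η : ℝ} (hη : 0 < η) (hηq : η ≤ 1 / (4 * (Nat.nth Nat.Prime n : ℝ))) :
    EdgeNonneg (Nat.nth Nat.Prime n) (Nat.nth Nat.Prime (n + 1)) η := by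
  refine edgeNonneg_nth_of_gap_le hq ?_ hη hηq
  by_contra hgap
  rw [not_le] at hgap
  exact hn (Finset.mem_filter.2 ⟨mem_range_of_nth_le hhi, hq, hhi, hgap⟩)

/-- **The cumulative exceptional set is power-small**, GIVEN Heath-Brown's theorem: for every `ε > 0` there is `C` with
`#(edgeExceptionalUpTo x) ≤ C·x^{1/10+ε}` for all `x > 0` (dyadic summation of `card_edgeExceptional_le`: with `a = 1/10 + ε`
and `S = 1/(1 − 2^{−a})`, induction on `k` over `x < e⁸⁰·2^k` using `#E(x) ≤ #E(x/2) + C·x^a` and `S·2^{−a} + 1 = S`).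
CONDITIONAL on the named fact `HeathBrown2021_sqrtGapSum`. [cite: HeathBrown2021DifferencesV, Thm 1; this track, ATTEMPT-10 §4] -/
theorem card_edgeExceptionalUpTo_le (hHB : Literature.NumberTheory.LFunctions.HeathBrown2021_sqrtGapSum) {ε : ℝ}
    (hε : 0 < ε) : ∃ C : ℝ, ∀ x : ℝ, 0 < x → ((edgeExceptionalUpTo x).card : ℝ) ≤ C * x ^ (1 / 10 + ε) := by
  obtain ⟨C₁, hC₁⟩ := card_edgeExceptional_le hHB hε
  set a : ℝ := 1 / 10 + ε with ha
  have ha0 : 0 < a := by rw [ha]; positivity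
  set t : ℝ := (2 : ℝ) ^ (-a) with ht
  have ht0 : 0 < t := Real.rpow_pos_of_pos (by norm_num) _
  have ht1 : t < 1 := Real.rpow_lt_one_of_one_lt_of_neg (by norm_num) (by linarith)
  set S : ℝ := 1 / (1 - t) with hS
  have hS0 : 0 < S := by rw [hS]; exact div_pos one_pos (by linarith)
  have hSid : S * t + 1 = S := by
    have hne : 1 - t ≠ 0 := by linarith
    rw [hS]; field_simp; ring
  set C₀ : ℝ := max C₁ 0 with hC₀
  have hC₀0 : 0 ≤ C₀ := le_max_right _ _
  have hC₁C₀ : C₁ ≤ C₀ := le_max_left _ _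
  have h16 : (16 : ℝ) < Real.exp 80 := by
    have := Real.add_one_le_exp (80 : ℝ); linarith
  -- the dyadic induction
  have key : ∀ k : ℕ, ∀ x : ℝ, 0 < x → x < Real.exp 80 * 2 ^ k →
      ((edgeExceptionalUpTo x).card : ℝ) ≤ C₀ * S * x ^ a := by
    intro k
    induction k with
    | zero =>
      intro x hx0 hx
      rw [pow_zero, mul_one] at hx
      rw [edgeExceptionalUpTo_eq_empty hx, Finset.card_empty, Nat.cast_zero]
      have : 0 ≤ x ^ a := Real.rpow_nonneg hx0.le _
      positivity
    | succ k ih =>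
      intro x hx0 hx
      by_cases hx16 : x < 16
      · rw [edgeExceptionalUpTo_eq_empty (hx16.trans h16), Finset.card_empty, Nat.cast_zero]
        have : 0 ≤ x ^ a := Real.rpow_nonneg hx0.le _
        positivity
      · rw [not_lt] at hx16
        have hhalf : x / 2 < Real.exp 80 * 2 ^ k := by
          rw [pow_succ] at hx; linarith
        have ih' := ih (x / 2) (by linarith) hhalf
        have hblock : ((edgeExceptional x).card : ℝ) ≤ C₀ * x ^ a := by
          have h1 := hC₁ x hx16
          have h2 : C₁ * x ^ a ≤ C₀ * x ^ a := mul_le_mul_of_nonneg_right hC₁C₀ (Real.rpow_nonneg hx0.le _)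
          exact h1.trans h2
        have hcard : ((edgeExceptionalUpTo x).card : ℝ) ≤
            ((edgeExceptionalUpTo (x / 2)).card : ℝ) + ((edgeExceptional x).card : ℝ) := by
          have h := (Finset.card_le_card (edgeExceptionalUpTo_subset x)).trans (Finset.card_union_le _ _)
          exact_mod_cast h
        have hpow : (x / 2) ^ a = x ^ a * t := by
          rw [ht, Real.div_rpow hx0.le (by norm_num), Real.rpow_neg (by norm_num), div_eq_mul_inv]
        rw [hpow] at ih'
        have hxa : 0 ≤ x ^ a := Real.rpow_nonneg hx0.le _
        calc ((edgeExceptionalUpTo x).card : ℝ) ≤ C₀ * S * (x ^ a * t) + C₀ * x ^ a := by linarith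
          _ = C₀ * (S * t + 1) * x ^ a := by ring
          _ = C₀ * S * x ^ a := by rw [hSid]
  refine ⟨C₀ * S, fun x hx0 ↦ ?_⟩
  -- choose k with x < e⁸⁰ · 2^k
  obtain ⟨k, hk⟩ := exists_nat_gt x
  have h2k : (k : ℝ) < (2 : ℝ) ^ k := by exact_mod_cast Nat.lt_two_pow_self
  have he : (1 : ℝ) ≤ Real.exp 80 := Real.one_le_exp (by norm_num)
  have hxk : x < Real.exp 80 * 2 ^ k := by
    have : (2 : ℝ) ^ k ≤ Real.exp 80 * 2 ^ k := by nlinarith [pow_pos (by norm_num : (0:ℝ) < 2) k]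
    linarith
  exact key k x hx0 hxk

/-- **The edge block holds for all but `≪ x^{1/10+ε}` of the primes up to `x`, given Heath-Brown 2021.** For every `ε > 0`
there is `C` such that for all `x > 0`: at most `C·x^{1/10+ε}` indices `n` with `e⁸⁰ ≤ p_n ≤ x` are exceptional, and at every
other such index `EdgeNonneg p_n p_{n+1} η` for all `0 < η ≤ 1/(4p_n)`. CONDITIONAL on `HeathBrown2021_sqrtGapSum`; nothing
at the exceptional primes, nothing about the coupling law, nothing about RH. [cite: HeathBrown2021DifferencesV, Thm 1; this track, ATTEMPT-10 §4] -/
theorem edgeNonneg_almost_all_upTo (hHB : Literature.NumberTheory.LFunctions.HeathBrown2021_sqrtGapSum) {ε : ℝ} (hε : 0 < ε) :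
    ∃ C : ℝ, ∀ x : ℝ, 0 < x →
      ((edgeExceptionalUpTo x).card : ℝ) ≤ C * x ^ (1 / 10 + ε) ∧
        ∀ n : ℕ, Real.exp 80 ≤ (Nat.nth Nat.Prime n : ℝ) → (Nat.nth Nat.Prime n : ℝ) ≤ x →
          n ∉ edgeExceptionalUpTo x → ∀ η : ℝ, 0 < η → η ≤ 1 / (4 * (Nat.nth Nat.Prime n : ℝ)) →
            EdgeNonneg (Nat.nth Nat.Prime n) (Nat.nth Nat.Prime (n + 1)) η := by
  obtain ⟨C, hC⟩ := card_edgeExceptionalUpTo_le hHB hε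
  exact ⟨C, fun x hx ↦ ⟨hC x hx, fun n hq hhi hn η hη hηq ↦
    edgeNonneg_nth_of_not_mem_edgeExceptionalUpTo hq hhi hn hη hηq⟩⟩

end Summit.RiemannHypothesis.RiemannHypothesis.Theorems.Handoff
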